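import Summits.QuantumFields.YangMills.Theorems.LuscherReductionDressedRitzPolyakovLiftReflectionSymmetry
import HarnessLib

/-!
# Line «polyakovlift» on crux `DressedRitz` (stmt-QuantumFields-20205), stub S-STAT: reflections of ALL three axes and the intrinsic PARITY
# `P : V ↦ V⁻¹` (total link inversion) are symmetries of the two-time forms — channels of opposite parity are exactly uncorrelated at all times

Fleet-service module of seat ym-infvol-p1 g6 (route `LuscherReduction`, femto rung R2b1; bears on the crux child `DressedRitz` = stmt-QuantumFields-20205,
skeleton r4 `11e28270fd13c0fc`, stubs S-STAT `stub_liftStatics` ∕ S-POS).  Sequel of `…PolyakovLiftReflectionSymmetry.lean` (this seat: `Θ'` = reflection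
of axis `0`; general separation lemma).  Conjugating `Θ'` by the transposition `(0 k) ∈ S₃` gives the reflection `R_k` of axis `k`; on the one-point
torus `R_k` inverts the link along axis `k` (`axisReflect_one_site_apply`), and the product `P = R₀R₁R₂` is the TOTAL LINK INVERSION `V ↦ (V₁⁻¹,V₂⁻¹,V₃⁻¹)`
(`linkInv_eq_axisReflects`) — the image of the central inversion `x ↦ −x` of the cubic lattice, i.e. the INTRINSIC PARITY that labels the femto-universe
levels `A₁^±, E^±, T₂^±, …` [cite: Luscher1983, §2] [cite: LuscherMunster1984, §2].

* §1 one-site bookkeeping: `axisReflect_one_site_apply`, `linkInv_eq_axisReflects`;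
* §2 ★ `l2_iterIns_comp_axisReflect` (`B_{a,b}(F∘R_k, H∘R_k) = B_{a,b}(F,H)`), ★ `l2_iterIns_comp_linkInv` (`B_{a,b}(F∘P, H∘P) = B_{a,b}(F,H)`),
  `isPhys_comp_linkInv`;
* §3 ★★ `dressedLiftFamily_o2_o6_of_linkParity`: for a lift basis with `g_i` PARITY-EVEN (`g_i(V⁻¹) = g_i(V)`) and `g_l` PARITY-ODD (`g_l(V⁻¹) = −g_l(V)`),
  clause (o2) of S-STAT and clause (o6) of S-POS hold for the pair with ANY `C ≥ 0` (exact zeros), for every raw vacuum — e.g. an `A₁⁺` channel against an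
  `A₁⁻` channel, which no axis permutation separates.

HONEST FRAMING: fixed-lattice symmetry bookkeeping on the conditional femto rung R2b1; no renormalisation-group content; nothing here bears on infinite
volume, the continuum limit or the Clay gap.  References: M. Lüscher, NPB 219 (1983) 233, §2 [cite: Luscher1983, §2]; M. Lüscher, G. Münster, NPB 232
(1984) 445, §2 [cite: LuscherMunster1984, §2]; M. Lüscher, U. Wolff, NPB 339 (1990) 222 [cite: LuscherWolff1990].
-/

set_option autoImplicit false

noncomputable section

open MeasureTheory Filter Topology Real
open Literature.MathematicalPhysics.QuantumFieldTheory
open scoped BigOperators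

namespace Summit.QuantumFields.YangMills.Theorems.FemtoTransferGap.PolyakovLift

open Summit.QuantumFields.YangMills.Theorems.FemtoTransferGap

/-! ## §1 One-site bookkeeping: conjugated reflections invert one link; their product inverts all three -/

section OneSite

variable {G : Type*} [Group G] [MeasurableSpace G]

/-- **`R_k = (0 k)·Θ'·(0 k)` inverts the link along axis `k`** on the one-point torus: `(R_k V)(x, μ) = V(x, μ)⁻¹` if `μ = k`, else `V(x, μ)`. [folklore] -/
theorem axisReflect_one_site_apply (k : Fin 3) (V : GaugeConfig 3 1 G) (x : Site 3 1) (μ : Fin 3) :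
    configPerm (Equiv.swap 0 k) ((configPerm (Equiv.swap 0 k) V).negReflect) (x, μ) = if μ = k then (V (x, μ))⁻¹ else V (x, μ) := by
  have hx : ∀ y : Site 3 1, y = x := fun y => Subsingleton.elim y x
  have hss : (Equiv.swap (0 : Fin 3) k).symm = Equiv.swap 0 k := Equiv.symm_swap 0 k
  have hiff : (Equiv.swap (0 : Fin 3) k) μ = 0 ↔ μ = k := by
    rw [Equiv.apply_eq_iff_eq_symm_apply, hss, Equiv.swap_apply_left]
  rw [configPerm_apply, hss, negReflect_one_site_apply, configPerm_apply, hss, Equiv.swap_apply_self, hx (sitePerm _ _)]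
  by_cases hμ : μ = k
  · rw [if_pos (hiff.mpr hμ), if_pos hμ]
  · rw [if_neg (fun h => hμ (hiff.mp h)), if_neg hμ]

/-- **Total link inversion is the product of the three axis reflections**: `V⁻¹ = R₀(R₁(R₂ V))` on the one-point torus. [folklore] -/
theorem linkInv_eq_axisReflects (V : GaugeConfig 3 1 G) :
    (fun e => (V e)⁻¹ : GaugeConfig 3 1 G) =
      configPerm (Equiv.swap 0 0) ((configPerm (Equiv.swap 0 0)
        (configPerm (Equiv.swap 0 1) ((configPerm (Equiv.swap 0 1)
          (configPerm (Equiv.swap 0 2) ((configPerm (Equiv.swap 0 2) V).negReflect))).negReflect))).negReflect) := by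
  funext e
  obtain ⟨x, μ⟩ := e
  rw [axisReflect_one_site_apply, axisReflect_one_site_apply, axisReflect_one_site_apply]
  fin_cases μ <;> simp

end OneSite

/-! ## §2 The two-time forms are invariant under every axis reflection and under the intrinsic parity -/

section Forms

variable {L : ℕ} [NeZero L]

/-- ★ **`B_{a,b}(F∘R_k, H∘R_k) = B_{a,b}(F,H)`** for the reflection `R_k = (0 k)·Θ'·(0 k)` of axis `k` (raw vacuum `φ`; compose the `S₃`-invariance
of seat g5 with the `Θ'`-invariance). [cite: Luscher1983, §2] -/
theorem l2_iterIns_comp_axisReflect (β : ℝ) {φ : GaugeConfig 3 L SU2 → ℝ} (hφ : IsPhys φ)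
    (heig : transferApply β φ = levelValue su2Rep L β 0 • φ) (t : ℝ) (k : Fin 3) (F H : GaugeConfig 3 1 SU2 → ℝ) (a b : ℕ) :
    l2 ((transferApply β)^[a] (OpPlat.ins φ (flowLiftAt 0 t fun V =>
          F (configPerm (Equiv.swap 0 k) ((configPerm (Equiv.swap 0 k) V).negReflect)))))
        ((transferApply β)^[b] (OpPlat.ins φ (flowLiftAt 0 t fun V =>
          H (configPerm (Equiv.swap 0 k) ((configPerm (Equiv.swap 0 k) V).negReflect))))) =
      l2 ((transferApply β)^[a] (OpPlat.ins φ (flowLiftAt 0 t F))) ((transferApply β)^[b] (OpPlat.ins φ (flowLiftAt 0 t H))) := by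
  set s := Equiv.swap (0 : Fin 3) k with hs
  -- outer axis permutation, then the reflection, then the inner axis permutation
  have h1 := l2_iterIns_comp_configPerm β hφ heig s t (fun W => F (configPerm s W.negReflect)) (fun W => H (configPerm s W.negReflect)) a b
  have h2 := l2_iterIns_comp_negReflect β hφ heig t (fun W => F (configPerm s W)) (fun W => H (configPerm s W)) a b
  have h3 := l2_iterIns_comp_configPerm β hφ heig s t F H a b
  exact (h1.trans h2).trans h3

/-- `F ∘ R_k` is physical when `F` is. [cite: Luscher1983, §2] -/
theorem isPhys_comp_axisReflect (k : Fin 3) {F : GaugeConfig 3 1 SU2 → ℝ} (hF : IsPhys F) :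
    IsPhys fun V : GaugeConfig 3 1 SU2 => F (configPerm (Equiv.swap 0 k) ((configPerm (Equiv.swap 0 k) V).negReflect)) :=
  ((hF.comp_configPerm (Equiv.swap 0 k)).comp_negReflect).comp_configPerm (Equiv.swap 0 k)

/-- ★ **The two-time forms are PARITY-invariant**: `B_{a,b}(F∘P, H∘P) = B_{a,b}(F,H)` for the total link inversion `P V = V⁻¹` of the one-site model
(`P = R₀R₁R₂`). [cite: Luscher1983, §2] [cite: LuscherMunster1984, §2] -/
theorem l2_iterIns_comp_linkInv (β : ℝ) {φ : GaugeConfig 3 L SU2 → ℝ} (hφ : IsPhys φ)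
    (heig : transferApply β φ = levelValue su2Rep L β 0 • φ) (t : ℝ) (F H : GaugeConfig 3 1 SU2 → ℝ) (a b : ℕ) :
    l2 ((transferApply β)^[a] (OpPlat.ins φ (flowLiftAt 0 t fun V => F (fun e => (V e)⁻¹))))
        ((transferApply β)^[b] (OpPlat.ins φ (flowLiftAt 0 t fun V => H (fun e => (V e)⁻¹)))) =
      l2 ((transferApply β)^[a] (OpPlat.ins φ (flowLiftAt 0 t F))) ((transferApply β)^[b] (OpPlat.ins φ (flowLiftAt 0 t H))) := by
  simp only [linkInv_eq_axisReflects]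
  -- peel the reflections from the outside in: `V ↦ F(R₀(R₁(R₂ V)))` is `F'' ∘ R₂` with `F'' = F ∘ R₀ ∘ R₁`, etc.
  have h2 := l2_iterIns_comp_axisReflect β hφ heig t 2
    (fun W => F (configPerm (Equiv.swap 0 0) ((configPerm (Equiv.swap 0 0)
          (configPerm (Equiv.swap 0 1) ((configPerm (Equiv.swap 0 1) W).negReflect))).negReflect)))
    (fun W => H (configPerm (Equiv.swap 0 0) ((configPerm (Equiv.swap 0 0)
          (configPerm (Equiv.swap 0 1) ((configPerm (Equiv.swap 0 1) W).negReflect))).negReflect))) a b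
  have h1 := l2_iterIns_comp_axisReflect β hφ heig t 1
    (fun W => F (configPerm (Equiv.swap 0 0) ((configPerm (Equiv.swap 0 0) W).negReflect)))
    (fun W => H (configPerm (Equiv.swap 0 0) ((configPerm (Equiv.swap 0 0) W).negReflect))) a b
  have h0 := l2_iterIns_comp_axisReflect β hφ heig t 0 F H a b
  exact (h2.trans h1).trans h0

/-- `F ∘ P` is physical when `F` is. [cite: Luscher1983, §2] -/
theorem isPhys_comp_linkInv {F : GaugeConfig 3 1 SU2 → ℝ} (hF : IsPhys F) :
    IsPhys fun V : GaugeConfig 3 1 SU2 => F (fun e => (V e)⁻¹) := by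
  simp only [linkInv_eq_axisReflects]
  exact isPhys_comp_axisReflect 2 (isPhys_comp_axisReflect 1 (isPhys_comp_axisReflect 0 hF))

end Forms

/-! ## §3 ★★ Parity-separated channels: (o2) and (o6) with ANY constant -/

section Parity

variable {L : ℕ} [NeZero L]

/-- ★★ **PARITY ZERO (intrinsic parity).**  For a lift basis with `g_i` EVEN and `g_l` ODD under the total link inversion `P V = V⁻¹` of the one-site
model (`g_i(V⁻¹) = g_i(V)`, `g_l(V⁻¹) = −g_l(V)`) and every raw vacuum `φ`, the dressed channels are exactly uncorrelated and uncoupled, so clause (o2)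
of `StaticClauses` (S-STAT) and clause (o6) of `DynamicCoreClauses` (S-POS) hold for the pair with ANY `C ≥ 0` (twirl over `{id, P}`, weights `½, ½`).
Example: an `A₁⁺` channel against an `A₁⁻` channel — a pair inside one `S₃`-isotypic class, invisible to the axis-permutation zeros.
[cite: Luscher1983, §2] [cite: LuscherMunster1984, §2] -/
theorem dressedLiftFamily_o2_o6_of_linkParity (β : ℝ) {φ : GaugeConfig 3 L SU2 → ℝ} (hvac : IsRawVacuum β φ)
    {B : ℝ} {k : ℕ} {ω : GaugeConfig 3 1 SU2 → ℝ} {g : Fin k → (GaugeConfig 3 1 SU2 → ℝ)} (hbasis : LiftBasis B k ω g)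
    {C : ℝ} (hC : 0 ≤ C) (i l : Fin k)
    (heven : ∀ V : GaugeConfig 3 1 SU2, g i (fun e => (V e)⁻¹) = g i V)
    (hodd : ∀ V : GaugeConfig 3 1 SU2, g l (fun e => (V e)⁻¹) = -g l V) :
    |l2 (dressedLiftFamily β φ g i) (dressedLiftFamily β φ g l)| ≤
        C * luscherLambda β L *
          (Real.sqrt (l2 (dressedLiftFamily β φ g i) (dressedLiftFamily β φ g i)) *
            Real.sqrt (l2 (dressedLiftFamily β φ g l) (dressedLiftFamily β φ g l))) ∧
      |l2 (dressedLiftFamily β φ g i) (transferApply β (dressedLiftFamily β φ g l)) -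
          (l2 (dressedLiftFamily β φ g i) (transferApply β (dressedLiftFamily β φ g i)) /
                l2 (dressedLiftFamily β φ g i) (dressedLiftFamily β φ g i) +
              l2 (dressedLiftFamily β φ g l) (transferApply β (dressedLiftFamily β φ g l)) /
                l2 (dressedLiftFamily β φ g l) (dressedLiftFamily β φ g l)) / 2 *
            l2 (dressedLiftFamily β φ g i) (dressedLiftFamily β φ g l)|
        ≤ C * (luscherLambda β L ^ 2 / L) * levelValue su2Rep L β 0 *
            (Real.sqrt (l2 (dressedLiftFamily β φ g i) (dressedLiftFamily β φ g i)) *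
              Real.sqrt (l2 (dressedLiftFamily β φ g l) (dressedLiftFamily β φ g l))) := by
  have hφ : IsPhys φ := hvac.1
  have heig : transferApply β φ = levelValue su2Rep L β 0 • φ := hvac.2.2
  -- the family `{id, P}` indexed by `Bool`, self-paired, weights `½`
  let γ : Bool → GaugeConfig 3 1 SU2 → GaugeConfig 3 1 SU2 := fun c V => bif c then (fun e => (V e)⁻¹) else V
  have hγ : ∀ c V, γ c (γ c V) = V := fun c V => by
    cases c
    · rfl
    · funext e; simp only [γ, cond_true, inv_inv]
  have hphys : ∀ c (F : GaugeConfig 3 1 SU2 → ℝ), IsPhys F → IsPhys fun V => F (γ c V) := fun c F hF => by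
    cases c
    · exact hF
    · exact isPhys_comp_linkInv hF
  have hinv : ∀ c (F H : GaugeConfig 3 1 SU2 → ℝ), IsPhys F → IsPhys H → ∀ a b : ℕ,
      l2 ((transferApply β)^[a] (OpPlat.ins φ (flowLiftAt (L := L) 0 (flowTime β L) fun V => F (γ c V))))
          ((transferApply β)^[b] (OpPlat.ins φ (flowLiftAt 0 (flowTime β L) fun V => H (γ c V)))) =
        l2 ((transferApply β)^[a] (OpPlat.ins φ (flowLiftAt (L := L) 0 (flowTime β L) F)))
          ((transferApply β)^[b] (OpPlat.ins φ (flowLiftAt 0 (flowTime β L) H))) := fun c F H _ _ a b => by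
    cases c
    · rfl
    · exact l2_iterIns_comp_linkInv β hφ heig (flowTime β L) F H a b
  refine dressedLiftFamily_o2_o6_of_twirl β hvac γ (Equiv.refl Bool) (fun c V => hγ c V) hphys hinv (fun _ => (1 / 2 : ℝ)) (fun _ => rfl)
    hbasis hC i l (fun V => ?_) (fun V => ?_)
  · simp only [γ, Fintype.sum_bool, cond_true, cond_false, heven]; ring
  · simp only [γ, Fintype.sum_bool, cond_true, cond_false, hodd]; ring

end Parity

end Summit.QuantumFields.YangMills.Theorems.FemtoTransferGap.PolyakovLift

end
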